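import Literature.NumberTheory.DiophantineGeometry.SymmetricGroupRepsFinrankSpechtProofs
import Literature.NumberTheory.DiophantineGeometry.SymmetricGroupRepsIrreducibleProofs
import HarnessLib

/-!
# Highest-weight spaces of `(k^N)^{⊗D}` as Specht modules (Schur–Weyl duality, module form)
(trunk ArithGeomL / CplxAlg; infrastructure for the Kronecker bound
`orbitMultiplicity_det_le_kroneckerCoeff` of `SchurWeylPlethysm`)

In the coordinate ("words") model `wordRep k N D` of the tensor power `(k^N)^{⊗D}`
(`TensorWordModel`), the symmetric group `𝔖_D` acts by permuting the positions (`wordPermRep`,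
`SymmetricGroupRepsFinrankSpechtProofs`), commuting with `GL_N`, hence on every space of
highest-weight vectors `HW_χ = highestWeightSpace (wordRep k N D) χ` (`hwPermRep`). This file
proves the `𝔖_D`-module form of Schur–Weyl duality for these spaces and a transposed variant:

* `spechtEquivHw`: for a partition `μ ⊢ D` with at most `N` parts, the orbit map of the
  row-reading tableau `x ↦ x · e_r` restricts to an `𝔖_D`-equivariant isomorphism
  `S^μ = k[𝔖_D] c_μ ≃ HW_μ((k^N)^{⊗D})` (characteristic zero); in particular the character of
  `𝔖_D` on `HW_μ` is the Specht character `χ^μ` (`character_hwPermRep`). Injectivity: `S^μ` is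
  irreducible (`isIrreducible_spechtRep_holds`) and `c_μ · e_r ≠ 0` (its `e_r`-coordinate is
  `|R_μ|`); surjectivity: both sides have dimension `f^μ` (`finrank_spechtIdeal_holds`,
  `hwMultiplicity_glTensorRep_holds`), the image consisting of highest-weight vectors
  (`polytabloid_mem`, `asAlgebraHom_mem_highestWeightSpace`).
* `transposedWeightSpace χ = {y | bᵀ · y = χ(b)⁻¹ y for all upper triangular b}` (the
  semi-invariants of the *lower* triangular Borel of weight `-χ`, which is how left translation
  by `B` acts on the column index of a matrix coefficient): the letter reversal
  `y ↦ y ∘ (rev ∘ ·)` (`letterRev`, the action of the longest Weyl element `w₀`) is an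
  `𝔖_D`-equivariant isomorphism onto `HW_{χ*}`, `χ* = -w₀ χ = Weight.dual χ`
  (`transposedEquivHw`), so its character is that of `HW_{χ*}` (`character_transposedPermRep`).

## Sources

* W. Fulton, J. Harris, *Representation Theory. A First Course*, GTM 129 (1991), §6.1
  (Thm. 6.3 (2): `V^{⊗d} ≅ ⊕_λ S_λV ⊗ V_λ` as `GL(V) × 𝔖_d`-modules; Lemma 6.22), §4.2
  (Problem 4.47: `V_λ = A c_λ` realised by polytabloids), §15.3 and Ex. 15.50 (`w₀`, dual
  highest weights). [cite: FultonHarrisGTM129, Thm. 6.3 (2) with Lemma 6.22]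
* W. Fulton, *Young Tableaux*, LMS Student Texts 35 (1997), §8.3, Cor. 1 (the
  `GL(E)`-decomposition `E^{⊗n} ≅ ⊕ (E^λ)^{⊕ f^λ}`, multiplicities `f^λ = dim S^λ`) and §7.2–§7.4.
  [cite: FultonYoungTableaux1997, §8.3 Cor. 1]
* G. D. James, *The Representation Theory of the Symmetric Groups*, LNM 682 (1978), 4.3–4.5,
  8.4. [cite: JamesLNM682, Theorem 8.4]

## Mathlib and tree

Used from Mathlib: `Representation.subrepresentation`, `Representation.Equiv.mk`,
`Representation.char_iso`, `Representation.IsIrreducible.injective_or_eq_zero`,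
`LinearMap.linearEquivOfInjective` (with Mathlib's instance `FiniteDimensional k (spechtIdeal k μ)`,
a left ideal of the finite-dimensional algebra `k[𝔖_D]`), `Matrix.GeneralLinearGroup.mkOfDetNeZero`,
`Fin.rev`.
From the tree: `wordRep`, `wordPerm`, `wordPerm_wordRep`, `wordPerm_mem_highestWeightSpace`,
`hwMultiplicity_glTensorRep_eq_wordRep` (`TensorWordModel`); `hwMultiplicity_glTensorRep_holds`,
`fst_lt_of_mem_youngDiagram`, `StdFilling.polytabloid_mem`, `StdFilling.polytabloid_apply_rowWord`,
`ydWeight_youngDiagram` (`SchurWeylPlethysmHwMultiplicityProofs`); `wordPermRep`, `orbitMap`,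
`orbitMap_mul`, `orbitMap_colAntisymmetrizer`, `rowReadingWord`, `rowReadingWord_comp_eq_iff`,
`asAlgebraHom_mem_highestWeightSpace`, `finrank_spechtIdeal_holds`
(`SymmetricGroupRepsFinrankSpechtProofs`); `isIrreducible_spechtRep_holds`
(`SymmetricGroupRepsIrreducibleProofs`). Mathlib has no Schur–Weyl duality.

## Design

`namespace Literature.CplxAlg`; `k` a field, of characteristic zero where the Specht theory needs it.
The `𝔖_D`-representations on subspaces of the word model are `Representation.subrepresentation`s
of `wordPermRep`. `transposeGL b` is the transpose of an invertible matrix as an element of `GL`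
(`Matrix.GeneralLinearGroup.mkOfDetNeZero`), and `revConjT b = w₀ bᵀ w₀` is given by its matrix
`(i, j) ↦ b (rev j) (rev i)`, which keeps the Borel computations elementary.
-/

noncomputable section

open scoped BigOperators Matrix

namespace Literature.NumberTheory.DiophantineGeometry

/-! ### `𝔖_D` on highest-weight spaces of the word model -/

section HwPerm

variable (k : Type*) [Field k] {N D : ℕ}

/-- The representation of `𝔖_D` (permuting the positions) on the space of highest-weight vectors
of weight `χ` of `(k^N)^{⊗D}` in the word model: the restriction of `wordPermRep` (the two
actions commute, `wordPerm_mem_highestWeightSpace`). Fulton–Harris §6.1 (Lemma 6.22,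
Thm. 6.3 (2)). [folklore] -/
def hwPermRep (χ : Weight (Fin N)) :
    Representation k (Equiv.Perm (Fin D)) (highestWeightSpace (wordRep k N D) χ) :=
  (wordPermRep k N D).subrepresentation (highestWeightSpace (wordRep k N D) χ)
    fun τ _ hc => wordPerm_mem_highestWeightSpace τ hc

/-- `hwPermRep` acts as `wordPerm` on underlying functions (unfolding lemma). [folklore] -/
@[simp]
theorem coe_hwPermRep_apply (χ : Weight (Fin N)) (τ : Equiv.Perm (Fin D))
    (c : highestWeightSpace (wordRep k N D) χ) :
    ((hwPermRep k χ τ c : highestWeightSpace (wordRep k N D) χ) : Word N D → k) = wordPerm k τ c :=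
  rfl

/-- A partition with at most `N` parts has all its boxes in rows `< N` (the hypothesis of the
polytabloid constructions). [folklore] -/
theorem forall_fst_lt_of_card_le (μ : Nat.Partition D) (hμ : μ.parts.card ≤ N) :
    ∀ x ∈ μ.youngDiagram.cells, x.1 < N :=
  fun _ hx => fst_lt_of_mem_youngDiagram μ hμ hx

/-! ### The Specht module inside the highest-weight space -/

/-- The orbit map `x ↦ x · e_r` of the row-reading word `r` of `μ`, restricted to the Specht
module `S^μ = k[𝔖_D] c_μ`, as a `k`-linear map into the word model (Fulton–Harris,
Problem 4.47: `V_λ = A c_λ → A · {T}`; James 4.3–4.5). [folklore] -/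
def spechtToWord (μ : Nat.Partition D) (hμ : μ.parts.card ≤ N) :
    spechtIdeal k μ →ₗ[k] (Word N D → k) :=
  orbitMap k (rowReadingWord μ (forall_fst_lt_of_card_le μ hμ)) ∘ₗ
    ((spechtIdeal k μ).subtype.restrictScalars k)

/-- Unfolding lemma for `spechtToWord`. [folklore] -/
theorem spechtToWord_apply (μ : Nat.Partition D) (hμ : μ.parts.card ≤ N) (x : spechtIdeal k μ) :
    spechtToWord k μ hμ x =
      orbitMap k (rowReadingWord μ (forall_fst_lt_of_card_le μ hμ)) (x : MonoidAlgebra k _) :=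
  rfl

/-- **Equivariance**: `spechtToWord (σ · x) = σ · spechtToWord x` (the orbit map is
`k[𝔖_D]`-linear, `orbitMap_mul`). [folklore] -/
theorem spechtToWord_spechtRep (μ : Nat.Partition D) (hμ : μ.parts.card ≤ N)
    (σ : Equiv.Perm (Fin D)) (x : spechtIdeal k μ) :
    spechtToWord k μ hμ (spechtRep k μ σ x) = wordPerm k σ (spechtToWord k μ hμ x) := by
  rw [spechtToWord_apply, spechtToWord_apply, spechtRep_apply, orbitMap_mul,
    Representation.asAlgebraHom_of, wordPermRep_apply]

/-- **The image consists of highest-weight vectors of weight `μ`**: `x c_μ · e_r = x a_μ · E_{T₀}`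
with `E_{T₀}` the polytabloid of the row-reading tableau, a highest-weight vector of weight `μ`
(`StdFilling.polytabloid_mem`), and `k[𝔖_D]` preserves the highest-weight space. Fulton,
*Young Tableaux*, §8.3 Cor. 1; Fulton–Harris Thm. 6.3 (2). [folklore] -/
theorem spechtToWord_mem [CharZero k] (μ : Nat.Partition D) (hμ : μ.parts.card ≤ N)
    (x : spechtIdeal k μ) :
    spechtToWord k μ hμ x ∈ highestWeightSpace (wordRep k N D) (Weight.ofPartition N μ) := by
  obtain ⟨z, hz⟩ := Ideal.mem_span_singleton'.mp x.2
  rw [spechtToWord_apply, ← hz, youngSymmetrizer, ← mul_assoc, orbitMap_mul,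
    orbitMap_colAntisymmetrizer, ← ydWeight_youngDiagram]
  exact asAlgebraHom_mem_highestWeightSpace k _
    ((StdFilling.rowReading μ).polytabloid_mem _ μ.card_cells_youngDiagram)

/-- The row-reading word is fixed by the row stabilizer: `r ∘ ρ = r` for `ρ ∈ R_μ`. [folklore] -/
theorem rowReadingWord_comp_of_mem (μ : Nat.Partition D)
    (hN : ∀ x ∈ μ.youngDiagram.cells, x.1 < N) {ρ : Equiv.Perm (Fin D)}
    (hρ : ρ ∈ rowStabilizer μ) : rowReadingWord μ hN ∘ ⇑ρ = rowReadingWord μ hN := by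
  have h := (rowReadingWord_comp_eq_iff μ hN 1 ρ⁻¹).mpr (by simpa using (rowStabilizer μ).inv_mem hρ)
  simpa using h

open scoped Classical in
/-- **Nonvanishing**: the `e_r`-coordinate of `c_μ · e_r = a_μ · E_{T₀}` is `|R_μ| ≠ 0`
(characteristic zero), so `spechtToWord c_μ ≠ 0`. Fulton, *Young Tableaux*, §8.2, Lemma 4 (the
coefficient of `e_T` in `e_T · c_T`); Fulton–Harris, proof of Thm. 15.47. [folklore] -/
theorem spechtToWord_youngSymmetrizer_apply_rowReadingWord (μ : Nat.Partition D)
    (hμ : μ.parts.card ≤ N) :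
    spechtToWord k μ hμ ⟨youngSymmetrizer k μ, youngSymmetrizer_mem_spechtIdeal k μ⟩
        (rowReadingWord μ (forall_fst_lt_of_card_le μ hμ)) =
      Fintype.card (rowStabilizer μ) := by
  classical
  set hN := forall_fst_lt_of_card_le μ hμ with hhN
  rw [spechtToWord_apply, Subtype.coe_mk, youngSymmetrizer, orbitMap_mul,
    orbitMap_colAntisymmetrizer]
  unfold rowSymmetrizer
  rw [map_sum, LinearMap.sum_apply]
  simp only [Representation.asAlgebraHom_of, wordPermRep_apply, Finset.sum_apply, wordPerm_apply]
  have hconst : ∀ ρ ∈ (rowStabilizer μ : Set (Equiv.Perm (Fin D))).toFinset,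
      (StdFilling.rowReading μ).polytabloid k hN (rowReadingWord μ hN ∘ ⇑ρ) = 1 := by
    intro ρ hρ
    rw [rowReadingWord_comp_of_mem μ hN (Set.mem_toFinset.mp hρ)]
    exact (StdFilling.rowReading μ).polytabloid_apply_rowWord hN
  rw [Finset.sum_congr rfl hconst, Finset.sum_const, nsmul_eq_mul, mul_one, Set.toFinset_card]
  rfl

/-- `spechtToWord c_μ ≠ 0` in characteristic zero. [folklore] -/
theorem spechtToWord_youngSymmetrizer_ne_zero [CharZero k] (μ : Nat.Partition D)
    (hμ : μ.parts.card ≤ N) :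
    spechtToWord k μ hμ ⟨youngSymmetrizer k μ, youngSymmetrizer_mem_spechtIdeal k μ⟩ ≠ 0 := by
  classical
  intro h
  have := spechtToWord_youngSymmetrizer_apply_rowReadingWord k μ hμ
  rw [h, Pi.zero_apply] at this
  exact (Nat.cast_ne_zero.mpr Fintype.card_ne_zero) this.symm

/-- The Specht intertwiner with values in the highest-weight space of weight `μ`
(codomain restriction of `spechtToWord`). [folklore] -/
def spechtToHw [CharZero k] (μ : Nat.Partition D) (hμ : μ.parts.card ≤ N) :
    spechtIdeal k μ →ₗ[k] highestWeightSpace (wordRep k N D) (Weight.ofPartition N μ) :=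
  (spechtToWord k μ hμ).codRestrict _ (spechtToWord_mem k μ hμ)

/-- `spechtToHw` is `spechtToWord` on underlying functions (unfolding lemma). [folklore] -/
@[simp]
theorem coe_spechtToHw [CharZero k] (μ : Nat.Partition D) (hμ : μ.parts.card ≤ N)
    (x : spechtIdeal k μ) : (spechtToHw k μ hμ x : Word N D → k) = spechtToWord k μ hμ x :=
  rfl

/-- `spechtToHw` as an intertwining map `S^μ → HW_μ` of representations of `𝔖_D`. [folklore] -/
def spechtToHwIntertwining [CharZero k] (μ : Nat.Partition D) (hμ : μ.parts.card ≤ N) :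
    (spechtRep k μ).IntertwiningMap (hwPermRep k (D := D) (Weight.ofPartition N μ)) :=
  ⟨spechtToHw k μ hμ, fun σ => LinearMap.ext fun x => Subtype.ext (spechtToWord_spechtRep k μ hμ σ x)⟩

/-- **Injectivity**: a nonzero intertwining map out of the irreducible `S^μ`
(`isIrreducible_spechtRep_holds`) is injective. Fulton–Harris Thm. 4.3 with Schur's lemma.
[folklore] -/
theorem spechtToHw_injective [CharZero k] (μ : Nat.Partition D) (hμ : μ.parts.card ≤ N) :
    Function.Injective (spechtToHw k μ hμ) := by
  haveI : (spechtRep k μ).IsIrreducible := isIrreducible_spechtRep_holds μ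
  rcases Representation.IsIrreducible.injective_or_eq_zero (spechtToHwIntertwining k μ hμ) with
    h | h
  · exact fun x y hxy => h hxy
  · exfalso
    apply spechtToWord_youngSymmetrizer_ne_zero k μ hμ
    have h' := LinearMap.congr_fun (congrArg Representation.IntertwiningMap.toLinearMap h)
      ⟨youngSymmetrizer k μ, youngSymmetrizer_mem_spechtIdeal k μ⟩
    exact congrArg Subtype.val h'

/-- **Dimensions agree**: `dim S^μ = f^μ = dim HW_μ((k^N)^{⊗D})` for `μ` with at most `N` parts
(`finrank_spechtIdeal_holds`; `hwMultiplicity_glTensorRep_holds` transported to the word model).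
Fulton, *Young Tableaux*, §8.3 Cor. 1. [folklore] -/
theorem finrank_spechtIdeal_eq_finrank_highestWeightSpace [CharZero k] (μ : Nat.Partition D)
    (hμ : μ.parts.card ≤ N) :
    Module.finrank k (spechtIdeal k μ) =
      Module.finrank k (highestWeightSpace (wordRep k N D) (Weight.ofPartition N μ)) := by
  rw [finrank_spechtIdeal_holds k μ]
  have h := hwMultiplicity_glTensorRep_holds k (d := D) μ hμ
  rw [hwMultiplicity_glTensorRep_eq_wordRep] at h
  exact h.symm

/-- **Schur–Weyl duality, module form**: `S^μ ≃ HW_μ((k^N)^{⊗D})` as representations of `𝔖_D`,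
for `μ ⊢ D` with at most `N` parts, in characteristic zero: the `𝔖_d`-module paired with the
Weyl module `S_μ V` in `V^{⊗d} ≅ ⊕ S_μV ⊗ V_μ` is the Specht module `V_μ` (Fulton–Harris
Thm. 6.3 (2) with Lemma 6.22; cf. Fulton, *Young Tableaux*, §8.3 Cor. 1, the
`GL(E)`-decomposition `E^{⊗n} ≅ ⊕ (E^λ)^{⊕ f^λ}`). [cite: FultonHarrisGTM129, Thm. 6.3 (2) with Lemma 6.22] -/
def spechtEquivHw [CharZero k] (μ : Nat.Partition D) (hμ : μ.parts.card ≤ N) :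
    (spechtRep k μ).Equiv (hwPermRep k (D := D) (Weight.ofPartition N μ)) :=
  Representation.Equiv.mk
    (LinearMap.linearEquivOfInjective (spechtToHw k μ hμ) (spechtToHw_injective k μ hμ)
      (finrank_spechtIdeal_eq_finrank_highestWeightSpace k μ hμ))
    fun σ => LinearMap.ext fun x => Subtype.ext (spechtToWord_spechtRep k μ hμ σ x)

/-- **The character of `𝔖_D` on `HW_μ((k^N)^{⊗D})` is the Specht character `χ^μ`** (for `μ` with
at most `N` parts, characteristic zero). Fulton–Harris Thm. 6.3 (2).
[cite: FultonHarrisGTM129, Thm. 6.3 (2)] -/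
theorem character_hwPermRep [CharZero k] (μ : Nat.Partition D) (hμ : μ.parts.card ≤ N) :
    (hwPermRep k (D := D) (Weight.ofPartition N μ)).character = spechtCharacter k μ :=
  (Representation.char_iso (spechtEquivHw k μ hμ)).symm

end HwPerm

/-! ### The transposed Borel: `{y | bᵀ y = χ(b)⁻¹ y}` and the letter reversal `w₀` -/

section Transposed

variable (k : Type*) [Field k] {N D : ℕ}

/-- The transpose of an invertible matrix as an element of `GL_N(k)`. [folklore] -/
def transposeGL (b : GL (Fin N) k) : GL (Fin N) k :=
  Matrix.GeneralLinearGroup.mkOfDetNeZero (b : Matrix (Fin N) (Fin N) k)ᵀ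
    (by rw [Matrix.det_transpose]; exact (Matrix.isUnits_det_units b).ne_zero)

/-- The matrix of `transposeGL b` is `bᵀ` (unfolding lemma). [folklore] -/
@[simp]
theorem coe_transposeGL (b : GL (Fin N) k) :
    ((transposeGL k b : GL (Fin N) k) : Matrix (Fin N) (Fin N) k) = (b : Matrix (Fin N) (Fin N) k)ᵀ :=
  Matrix.GeneralLinearGroup.val_mkOfDetNeZero _ _

/-- `w₀ bᵀ w₀`: the invertible matrix `(i, j) ↦ b (rev j) (rev i)` (conjugate of the transpose by
the order-reversing permutation matrix). For upper triangular `b` it is upper triangular with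
reversed diagonal (`isUpperTriangular_revConjT`, `weightChar_revConjT`). Fulton–Harris §15.3
(the longest element of the Weyl group). [folklore] -/
def revConjT (b : GL (Fin N) k) : GL (Fin N) k :=
  Matrix.GeneralLinearGroup.mkOfDetNeZero
    (((b : Matrix (Fin N) (Fin N) k).submatrix Fin.rev Fin.rev)ᵀ)
    (by
      rw [Matrix.det_transpose,
        show ((b : Matrix (Fin N) (Fin N) k).submatrix Fin.rev Fin.rev) =
          (b : Matrix (Fin N) (Fin N) k).submatrix ⇑Fin.revPerm ⇑Fin.revPerm from rfl,
        Matrix.det_submatrix_equiv_self]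
      exact (Matrix.isUnits_det_units b).ne_zero)

/-- Entries of `revConjT b`: `(i, j) ↦ b (rev j) (rev i)`. [folklore] -/
@[simp]
theorem revConjT_apply (b : GL (Fin N) k) (i j : Fin N) :
    ((revConjT k b : GL (Fin N) k) : Matrix (Fin N) (Fin N) k) i j =
      (b : Matrix (Fin N) (Fin N) k) (Fin.rev j) (Fin.rev i) := by
  rw [revConjT, Matrix.GeneralLinearGroup.val_mkOfDetNeZero]
  rfl

/-- `revConjT` is an involution. [folklore] -/
theorem revConjT_revConjT (b : GL (Fin N) k) : revConjT k (revConjT k b) = b := by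
  apply Units.ext
  ext i j
  rw [revConjT_apply, revConjT_apply, Fin.rev_rev, Fin.rev_rev]

/-- `w₀ bᵀ w₀` is upper triangular when `b` is. Fulton–Harris §15.3. [folklore] -/
theorem isUpperTriangular_revConjT {b : GL (Fin N) k} (hb : IsUpperTriangular b) :
    IsUpperTriangular (revConjT k b) := by
  intro i j hij
  rw [revConjT_apply]
  exact hb.apply_eq_zero (Fin.rev_lt_rev.mpr hij)

/-- The weight character of `w₀ bᵀ w₀` is that of `b` for the reversed weight:
`χ(w₀ bᵀ w₀) = (χ ∘ rev)(b)`. Fulton–Harris §15.3, Ex. 15.50. [folklore] -/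
theorem weightChar_revConjT (χ : Weight (Fin N)) (b : GL (Fin N) k) :
    weightChar χ (revConjT k b) = weightChar (χ ∘ Fin.rev) b := by
  unfold weightChar
  simp only [revConjT_apply, Function.comp_apply]
  exact Fintype.prod_equiv Fin.revPerm _ _ fun i => by simp only [Fin.revPerm_apply, Fin.rev_rev]

/-- For the dual weight `χ* = -w₀χ`: `χ*(w₀ bᵀ w₀) = χ(b)⁻¹` on upper triangular `b`.
Fulton–Harris Ex. 15.50. [folklore] -/
theorem weightChar_dual_revConjT (χ : Weight (Fin N)) (b : GL (Fin N) k) :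
    weightChar χ.dual (revConjT k b) = (weightChar χ b)⁻¹ := by
  rw [weightChar_revConjT]
  unfold weightChar
  rw [← Finset.prod_inv_distrib]
  refine Finset.prod_congr rfl fun i _ => ?_
  rw [Function.comp_apply, Weight.dual, Fin.rev_rev, zpow_neg]

variable (N D)

/-- The **letter reversal** `w₀` on the word model: `(letterRev y)(w) = y (rev ∘ w)` (the action
of the order-reversing permutation matrix on `(k^N)^{⊗D}`, an involutive linear automorphism
commuting with `𝔖_D`). Fulton–Harris §15.3. [folklore] -/
def letterRev : (Word N D → k) ≃ₗ[k] (Word N D → k) where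
  toFun y w := y (Fin.rev ∘ w)
  invFun y w := y (Fin.rev ∘ w)
  map_add' _ _ := rfl
  map_smul' _ _ := rfl
  left_inv y := by
    funext w
    change y (Fin.rev ∘ (Fin.rev ∘ w)) = y w
    congr 1
    funext p
    simp
  right_inv y := by
    funext w
    change y (Fin.rev ∘ (Fin.rev ∘ w)) = y w
    congr 1
    funext p
    simp

variable {N D}

/-- Unfolding lemma for `letterRev`. [folklore] -/
@[simp]
theorem letterRev_apply (y : Word N D → k) (w : Word N D) : letterRev k N D y w = y (Fin.rev ∘ w) :=
  rfl

/-- `letterRev` is an involution. [folklore] -/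
@[simp]
theorem letterRev_letterRev (y : Word N D → k) : letterRev k N D (letterRev k N D y) = y :=
  (letterRev k N D).left_inv y

/-- `letterRev` commutes with the permutations of the positions. [folklore] -/
theorem letterRev_wordPerm (τ : Equiv.Perm (Fin D)) (y : Word N D → k) :
    letterRev k N D (wordPerm k τ y) = wordPerm k τ (letterRev k N D y) :=
  rfl

/-- **`w₀` conjugates `bᵀ` into `w₀ bᵀ w₀`**: `letterRev (bᵀ · y) = (w₀ bᵀ w₀) · letterRev y` in the
word model. Fulton–Harris §15.3. [folklore] -/
theorem letterRev_wordRep_transposeGL (b : GL (Fin N) k) (y : Word N D → k) :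
    letterRev k N D (wordRep k N D (transposeGL k b) y) =
      wordRep k N D (revConjT k b) (letterRev k N D y) := by
  funext w
  rw [letterRev_apply, wordRep_apply, wordRep_apply]
  let e : Word N D ≃ Word N D :=
    { toFun := fun u => Fin.rev ∘ u
      invFun := fun u => Fin.rev ∘ u
      left_inv := fun u => by funext p; simp
      right_inv := fun u => by funext p; simp }
  refine Fintype.sum_equiv e _ _ fun u => ?_
  have hu : (e u : Word N D) = Fin.rev ∘ u := rfl
  congr 1
  · refine Finset.prod_congr rfl fun p _ => ?_
    rw [hu, coe_transposeGL, Matrix.transpose_apply, revConjT_apply]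
    simp only [Function.comp_apply, Fin.rev_rev]
  · rw [letterRev_apply, hu]
    congr 1
    funext p
    simp

variable (N D)

/-- The **transposed weight space** of weight `χ`: functions `y` on words with
`bᵀ · y = χ(b)⁻¹ y` for every upper triangular invertible `b` (the semi-invariants of the lower
triangular Borel subgroup of weight `-χ`). This is the condition satisfied by the columns of the
coefficient matrix of a left `B`-semi-invariant matrix coefficient (`PairWordPolynomials`).
Fulton–Harris §15.3, Ex. 15.50. [folklore] -/
def transposedWeightSpace (χ : Weight (Fin N)) : Submodule k (Word N D → k) where
  carrier := {y | ∀ b : GL (Fin N) k, IsUpperTriangular b →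
    wordRep k N D (transposeGL k b) y = (weightChar χ b)⁻¹ • y}
  add_mem' {y y'} hy hy' b hb := by rw [map_add, hy b hb, hy' b hb, smul_add]
  zero_mem' b hb := by rw [map_zero, smul_zero]
  smul_mem' c {y} hy b hb := by rw [map_smul, hy b hb, smul_comm]

variable {N D}

/-- Membership in the transposed weight space (unfolding lemma). [folklore] -/
theorem mem_transposedWeightSpace_iff (χ : Weight (Fin N)) (y : Word N D → k) :
    y ∈ transposedWeightSpace k N D χ ↔ ∀ b : GL (Fin N) k, IsUpperTriangular b →
      wordRep k N D (transposeGL k b) y = (weightChar χ b)⁻¹ • y :=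
  Iff.rfl

/-- **`w₀` maps the transposed weight space of weight `χ` into the highest-weight space of the dual
weight `χ* = -w₀χ`.** Fulton–Harris §15.3, Ex. 15.50. [folklore] -/
theorem letterRev_mem_highestWeightSpace {χ : Weight (Fin N)} {y : Word N D → k}
    (hy : y ∈ transposedWeightSpace k N D χ) :
    letterRev k N D y ∈ highestWeightSpace (wordRep k N D) χ.dual := by
  intro b' hb'
  have hb : IsUpperTriangular (revConjT k b') := isUpperTriangular_revConjT k hb'
  have h := congrArg (letterRev k N D) (hy _ hb)
  rw [letterRev_wordRep_transposeGL, revConjT_revConjT, map_smul] at h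
  have hw := weightChar_dual_revConjT k χ (revConjT k b')
  rw [revConjT_revConjT] at hw
  rw [h, hw]

/-- Conversely, if `w₀ y` is a highest-weight vector of weight `χ*` then `y` lies in the
transposed weight space of weight `χ`. Fulton–Harris §15.3. [folklore] -/
theorem mem_transposedWeightSpace_of_letterRev_mem {χ : Weight (Fin N)} {y : Word N D → k}
    (hy : letterRev k N D y ∈ highestWeightSpace (wordRep k N D) χ.dual) :
    y ∈ transposedWeightSpace k N D χ := by
  intro b hb
  have h := hy _ (isUpperTriangular_revConjT k hb)
  rw [← letterRev_wordRep_transposeGL, weightChar_dual_revConjT k χ b] at h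
  have h' := congrArg (letterRev k N D) h
  rwa [letterRev_letterRev, map_smul, letterRev_letterRev] at h'

/-- The transposed weight space is the preimage of `HW_{χ*}` under `w₀`. [folklore] -/
theorem mem_transposedWeightSpace_iff_letterRev_mem (χ : Weight (Fin N)) (y : Word N D → k) :
    y ∈ transposedWeightSpace k N D χ ↔
      letterRev k N D y ∈ highestWeightSpace (wordRep k N D) χ.dual :=
  ⟨letterRev_mem_highestWeightSpace k, mem_transposedWeightSpace_of_letterRev_mem k⟩

/-- The transposed weight space is stable under the permutations of the positions (which commute
with `GL_N`). [folklore] -/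
theorem wordPerm_mem_transposedWeightSpace (τ : Equiv.Perm (Fin D)) {χ : Weight (Fin N)}
    {y : Word N D → k} (hy : y ∈ transposedWeightSpace k N D χ) :
    wordPerm k τ y ∈ transposedWeightSpace k N D χ := by
  intro b hb
  rw [← wordPerm_wordRep, hy b hb, map_smul]

/-- The representation of `𝔖_D` on the transposed weight space (restriction of `wordPermRep`).
[folklore] -/
def transposedPermRep (χ : Weight (Fin N)) :
    Representation k (Equiv.Perm (Fin D)) (transposedWeightSpace k N D χ) :=
  (wordPermRep k N D).subrepresentation (transposedWeightSpace k N D χ)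
    fun τ _ hy => wordPerm_mem_transposedWeightSpace k τ hy

/-- `transposedPermRep` acts as `wordPerm` on underlying functions (unfolding lemma). [folklore] -/
@[simp]
theorem coe_transposedPermRep_apply (χ : Weight (Fin N)) (τ : Equiv.Perm (Fin D))
    (y : transposedWeightSpace k N D χ) :
    ((transposedPermRep k χ τ y : transposedWeightSpace k N D χ) : Word N D → k) = wordPerm k τ y :=
  rfl

/-- **`w₀` : transposed weight space of weight `χ` ≃ `HW_{χ*}`**, a linear isomorphism
(restriction of the involution `letterRev`). Fulton–Harris §15.3, Ex. 15.50. [folklore] -/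
def transposedEquivHwLinear (χ : Weight (Fin N)) :
    transposedWeightSpace k N D χ ≃ₗ[k] highestWeightSpace (wordRep k N D) χ.dual where
  toFun y := ⟨letterRev k N D y, letterRev_mem_highestWeightSpace k y.2⟩
  invFun c := ⟨letterRev k N D c, mem_transposedWeightSpace_of_letterRev_mem k
    (by rw [letterRev_letterRev]; exact c.2)⟩
  map_add' _ _ := rfl
  map_smul' _ _ := rfl
  left_inv y := Subtype.ext (letterRev_letterRev k _)
  right_inv c := Subtype.ext (letterRev_letterRev k _)

/-- **`w₀` is an equivalence of `𝔖_D`-representations** between the transposed weight space of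
weight `χ` and `HW_{χ*}((k^N)^{⊗D})`. Fulton–Harris §15.3 with Lemma 6.22. [folklore] -/
def transposedEquivHw (χ : Weight (Fin N)) :
    (transposedPermRep k (D := D) χ).Equiv (hwPermRep k (D := D) χ.dual) :=
  Representation.Equiv.mk (transposedEquivHwLinear k χ) fun _ => LinearMap.ext fun _ => rfl

/-- The character of `𝔖_D` on the transposed weight space of weight `χ` equals its character on
`HW_{χ*}`. [folklore] -/
theorem character_transposedPermRep (χ : Weight (Fin N)) :
    (transposedPermRep k (D := D) χ).character = (hwPermRep k (D := D) χ.dual).character :=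
  Representation.char_iso (transposedEquivHw k χ)

/-- **The character of `𝔖_D` on the transposed weight space of the dual weight `λ*` of a partition
`λ ⊢ D` with at most `N` parts is the Specht character `χ^λ`** (characteristic zero):
`transposedEquivHw` followed by `spechtEquivHw` (`λ** = λ`). Fulton–Harris Thm. 6.3 (2),
Ex. 15.50. [cite: FultonHarrisGTM129, Thm. 6.3 (2)] -/
theorem character_transposedPermRep_dualOfPartition [CharZero k] (lam : Nat.Partition D)
    (hlam : lam.parts.card ≤ N) :
    (transposedPermRep k (D := D) (Weight.dualOfPartition N lam)).character =
      spechtCharacter k lam := by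
  rw [character_transposedPermRep, Weight.dualOfPartition, Weight.dual_dual,
    character_hwPermRep k lam hlam]

end Transposed

end Literature.NumberTheory.DiophantineGeometry
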